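import Summits.CriticalPhenomena.SAWScalingLimit.Theses.SAWCircleScreening
import HarnessLib

/-!
# `CruxesGiveTarget` (route SAWCircleScreening, item stmt-CriticalPhenomena-14157) — proved

Glue concluding the route's target: `EndpointCoupling → SomeApproxLimit → Target`.

`Target` (rank 0 of route SAWCircleScreening) is the conjunction `(EC) ∧ (I₁)` with both conjuncts
inlined verbatim: its first conjunct is literally the body of `EndpointCoupling` and its second
literally the body of `SomeApproxLimit` (the target is rendered before the crux declarations in the
route file, so it cannot name them). The proof is therefore definitional unfolding followed by
pairing the two hypotheses; no mathematics beyond `And.intro` is involved and no hypothesis of the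
route other than the two conjuncts is used.
-/

namespace Summit.CriticalPhenomena.SAWScalingLimit.Theorems

/-- **`CruxesGiveTarget` holds** (item stmt-CriticalPhenomena-14157 of route SAWCircleScreening):
`EndpointCoupling → SomeApproxLimit → Target`. After unfolding the four route definitions the
target is syntactically the conjunction of the two hypotheses, so the proof is `⟨h₁, h₂⟩`. -/
theorem CruxesGiveTarget_proof :
    Summit.CriticalPhenomena.SAWScalingLimit.Theses.SAWCircleScreening.CruxesGiveTarget := by
  unfold Summit.CriticalPhenomena.SAWScalingLimit.Theses.SAWCircleScreening.CruxesGiveTarget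
    Summit.CriticalPhenomena.SAWScalingLimit.Theses.SAWCircleScreening.Target
    Summit.CriticalPhenomena.SAWScalingLimit.Theses.SAWCircleScreening.EndpointCoupling
    Summit.CriticalPhenomena.SAWScalingLimit.Theses.SAWCircleScreening.SomeApproxLimit
  intro h₁ h₂
  exact ⟨h₁, h₂⟩

end Summit.CriticalPhenomena.SAWScalingLimit.Theorems
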